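import Summits.QuantumFields.YangMills.Theorems.UnitScaleTiltFluctuationComparisonRegPrGlobalSlackKernelCauchyEstimates
import Summits.QuantumFields.YangMills.Theorems.UnitScaleTiltFluctuationComparisonRegPrGlobalSlackCanonicalOnChiChiCV4
import Summits.QuantumFields.YangMills.Theorems.UnitScaleTiltFluctuationComparisonRegPrGlobalSlackKernelCauchyEstimatesOn
import HarnessLib

/-!
# `UnitScaleTiltFluctuationComparisonRegPrGlobalSlackKernelCauchyEstimatesOnV4` — THE v4 TWIN (★★OWNER RULING g26-№14 (F-2b); P22b, width seat ym-ust-20520-w2 g4; skeleton v5kD; record-free decls imported from `…GlobalSlackKernelCauchyEstimatesOn`) of `…GlobalSlackKernelCauchyEstimatesOn` — THE SEVENTH-ORDER (σ = 7) TAYLOR ROW OF THE K1a CHART INTERFACE READ ON A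
# SUB-PREDICATE OF THE WINDOW, AND (i*)χ FROM THE DISPLAYED-SHAPE CHART ROWS ON PRINT'S χ
# (crux `FluctuationComparisonRegPrIntL`, stmt-QuantumFields-20520, skeleton v5kC STUB (i*)χ `stub_smallBlocksSlackOnChiAllChiV4`, odd `L ∈ {3,5}`; width seat ym-ust-20520-w2)

WHY.  Of the six chart rows the (i*)χ sockets read (`GlobalSlackCanonicalOnChi.K1aChartRowsOnChiKChiV4`, ★r1 g4 p577926), the remainder row `RemainderSmallΦOn χ` carries the
slack exponent `σ = 7` ([Balaban1985UV3] (57) p.270 «terms with an overall power greater than six»): it is the order-`≥ 7` Taylor rest of the charts at the chart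
configurations, plus the far terms.  Lane A discharged its FULL-WINDOW form from the displayed analyticity G3D-01 (`remainderSmallΦ_taylorRest`, p531504) under the
full-window configuration size row `CfgSizeΦ` — which is exactly the row that FAILS at `L ∈ {3,5}` on the window's edge band (cell FINDING #44/#56: the background
configuration of an edge datum leaves the chart's ball), and is why (i*)χ reads the three configuration rows only on print's χ-good data.  The Taylor estimate is
POINTWISE in the datum, so the restriction commutes with it:

* §1 `remainderSmallΦOn_add`, **`remainderSmallΦOn_taylorRest`**: `ChartAnalyticΦ ∧ Deriv1VanishΦ ∧ CfgSizeΦOn S` and the window `C_s·θ(n) ≤ ρ/4` ⟹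
  `RemainderSmallΦOn S D (taylorRest Φ B) b₀ p₀ κ (2C_A(2C_s/ρ)⁷)` for BOTH runs; `remainderSmallΦOn_of_chartAnalytic` (+ the far row ON `S`).
* §2 **`K1aDisplayedRowsOnChiKChiV4 L μ 𝔠 a₀ a₁ a`** — the (i*)χ chart rows in the DISPLAYED shape: analyticity `ChartAnalyticΦ … 𝔠.κ ρ C_A` (G3D-01), no linear term
  `Deriv1VanishΦ` ((32)), the far row and the two configuration rows ON χ, K1a, and the Taylor structure row with the HONEST rest `taylorRest Φ B + Rfar`; NO kernel-size
  row and NO seventh-order row (both are now theorems); `k1aChartRowsOnChiCChi_of_displayedRowsOnChiKChi` (window from `γ ≤ gammaθ b₀ p₀ (ρ/(4·max 1 C_s))`), and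
  **`smallBlocksSlackOnChiAllChiV4_of_displayedRowsOnChiKChiV4 : … → ⟨(i*)χ TEXT VERBATIM⟩`** through ★r1 g4's `smallBlocksSlackOnChiAllChiV4_of_k1aChartRowsOnChiCChiV4`.
After this file the (i*)χ line's independent chart rows are: G3D-01-shape analyticity and (32) for ONE chart family over both runs (displayed per run; two-run only
through the COMMON family — the recipe, F-g4-1), the far row ON χ (displayed `far_le` at the birth level), `CfgSizeΦOn χ`/`CfgCauchyΦOn χ` (19200-side, (27)/(M5)),
K1a `FlatKernelCauchyΦ` (the unprinted two-run number comparison) and the Taylor structure row at the old levels ((M1)).  Hypothesis schemas and their algebra only;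
nothing of [Balaban1985UV3]/[King1986] is asserted; no numerics; registry untouched (`--supports stmt-QuantumFields-20520`).  YM₃ on the torus is a rung of the
ladder, not the Clay problem; nothing here is a claim about the crux or the gap.

References: T. Bałaban, CMP 102 (1985) 255–275 [Balaban1985UV3] ((7) p.257, (25) p.262, (28)–(30) p.263, (32)–(34) p.264, (43)–(47) pp.266–267, (57) p.270);
C. King, CMP 102 (1986) 649–677 [King1986] (Thm 3.4 (3.9) p.656, Prop. 3.6 (3.55)–(3.56) p.662); S. B. Chae, Holomorphy and Calculus in Normed Spaces (1985) [Chae1985] (13.6).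
-/

set_option autoImplicit false

noncomputable section

open scoped BigOperators
open Metric Set
open Literature.MathematicalPhysics.QuantumFieldTheory.Balaban1983to89
open Literature.MathematicalPhysics.QuantumFieldTheory.Balaban1983to89.T3ContinuumYM3Torus
open Literature.MathematicalPhysics.QuantumFieldTheory.Balaban1983to89.T3UnitScaleTilt
open Literature.MathematicalPhysics.QuantumFieldTheory.Balaban1983to89.T3LevelShift
open Literature.MathematicalPhysics.QuantumFieldTheory.Balaban1983to89.T3AlphaInputsAC
open Literature.MathematicalPhysics.QuantumFieldTheory.Balaban1983to89.T3AlphaPolymerSocket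
open Literature.MathematicalPhysics.QuantumFieldTheory.Balaban1983to89.T3AlphaInputsACTwoRun
open Literature.MathematicalPhysics.QuantumFieldTheory.Balaban1983to89.T3AlphaInputsACTwoRunLevel
open Literature.MathematicalPhysics.QuantumFieldTheory.Balaban1985CMP102
open Literature.MathematicalPhysics.QuantumFieldTheory.Balaban1985CMP102.Setting
open Literature.MathematicalPhysics.QuantumFieldTheory.Balaban1985CMP102.Binders (ChartAnalyticityAsCited)
open Summit.QuantumFields.Balaban3D.Carriers
open Summit.QuantumFields.Balaban3D.Proofs.Primitives
open Summit.QuantumFields.Balaban3D.Proofs.GroupModelLieC (lieC)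
open Summit.QuantumFields.Balaban3D.Proofs.Representation33 (jet26)
open Summit.QuantumFields.YangMills.Theorems
open Summit.QuantumFields.YangMills.Theorems.GlobalSlackKernelMatching
open Summit.QuantumFields.YangMills.Theorems.GlobalSlackCanonicalPolymers
open Summit.QuantumFields.YangMills.Theorems.GlobalSlackCanonicalOnChi

namespace Summit.QuantumFields.YangMills.Theorems.GlobalSlackKernelMatchingOn

/-! ## §1 The seventh-order Taylor row on a sub-predicate of the window -/

section TaylorOn

variable {𝕍 : Type} [NormedAddCommGroup 𝕍] [NormedSpace ℂ 𝕍] {F : T3Family} {γ : ℝ}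

-- (record-free `remainderSmallΦOn_add`: imported from the v3 module, not restated)

-- (record-free `remainderSmallΦOn_taylorRest`: imported from the v3 module, not restated)

-- (record-free `remainderSmallΦOn_of_chartAnalytic`: imported from the v3 module, not restated)

-- (record-free `window_taylor_le`: imported from the v3 module, not restated)

end TaylorOn

/-! ## §2 (i*)χ from the displayed-shape chart rows on print's χ -/

section Displayed

/-- **THE (i*)χ CHART ROWS IN THE DISPLAYED SHAPE, ON PRINT'S χ, NO LETTER ON THE RECORD** (hypothesis schema, never asserted): ★r1 g4's `K1aChartRowsOnChiKChiV4` with the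
kernel-size row (34) and the seventh-order row (57) REPLACED by what the lane's step records display — analyticity `ChartAnalyticΦ … 𝔠.κ ρ C_A` (G3D-01 `chart`, both runs of
ONE family), no linear term `Deriv1VanishΦ` ((32), the lane's `Eq32FromInvariance`), a far-terms row ON χ (G3D-06 `far_le`) — and the Taylor structure row with the HONEST rest
`taylorRest Φ B + Rfar` and vacuum constants `vacOf Φ` (so it reads «the term IS `Re Φ(B) + Rfar`»: the displayed `hPY`/`hPYZ` identity at the birth level, (M1) at the old
levels); K1a `FlatKernelCauchyΦ` and the two configuration rows ON χ (`CfgSizeΦOn`, `CfgCauchyΦOn (ℓ ≡ 1)`) VERBATIM; decay rate the record's `𝔠.κ`.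
[cite: Balaban1985UV3, (25) p.262, (28)-(30) p.263, (32)-(33) p.264, (43)-(47) pp.266-267, (57) p.270; King1986, Thm 3.4 (3.9) p.656, Prop. 3.6 (3.56) p.662] -/
def K1aDisplayedRowsOnChiKChiV4 (L : ℕ) (μ : ℝ) (𝔠 : AlphaConsts L (suGroupModel 2).N) (a₀ a₁ a : ℝ) : Prop :=
  ∃ (ρ C_A C C_f C_s C_B γB : ℝ), 0 < ρ ∧ 0 ≤ C_A ∧ 0 ≤ C ∧ 0 ≤ C_f ∧ 0 ≤ C_s ∧ 0 ≤ C_B ∧ 0 < γB ∧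
    ∀ (F : T3Family) (γ : ℝ) (hF : F.L = L) (hγ : 0 < γ), γ ≤ γB → ∀ (hγ1 : γ ≤ (min (hF ▸ 𝔠).gamma0 1) ^ 2),
      AlphaInputsT3AC.OfV4ChiAt F (hF ▸ 𝔠) a₀ a₁ →
        ∃ (p : ∀ K, AlphaInputsT3AC.PkgAtV4Chi F (hF ▸ 𝔠) γ hγ hγ1 K), (∀ K, (p K).a₀ = a₀ ∧ (p K).a₁ = a₁) ∧
          ∀ ε₀ : ℝ, 0 < ε₀ → ε₀ ≤ a₀ →
          ∃ (Φ : ChartFam ↥(lieC (suGroupModel 2)) F) (B : CfgFam ↥(lieC (suGroupModel 2)) F) (Rfar : RemFam F),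
            TaylorSplitΦ (canonPTRows fun K => (p K).toRows) Φ (vacOf Φ) B (taylorRest Φ B + Rfar) ∧
            ChartAnalyticΦ (AlphaInputsT3AC.dataOfV4chi p (canonPolymerRows fun K => (p K).toRows)) Φ (hF ▸ 𝔠).κ ρ C_A ∧
            Deriv1VanishΦ Φ ∧
            FlatKernelCauchyΦ (AlphaInputsT3AC.dataOfV4chi p (canonPolymerRows fun K => (p K).toRows)) Φ (hF ▸ 𝔠).κ a C ∧
            RemainderSmallΦOn (fun K n h V => PrintChi.ChiGood F γ (hF ▸ 𝔠).b₀ (hF ▸ 𝔠).p₀ ε₀ μ (n := n) (K := K) h V)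
              (AlphaInputsT3AC.dataOfV4chi p (canonPolymerRows fun K => (p K).toRows)) Rfar (hF ▸ 𝔠).b₀ (hF ▸ 𝔠).p₀ (hF ▸ 𝔠).κ C_f ∧
            CfgSizeΦOn (fun K n h V => PrintChi.ChiGood F γ (hF ▸ 𝔠).b₀ (hF ▸ 𝔠).p₀ ε₀ μ (n := n) (K := K) h V)
              (AlphaInputsT3AC.dataOfV4chi p (canonPolymerRows fun K => (p K).toRows)) B (hF ▸ 𝔠).b₀ (hF ▸ 𝔠).p₀ C_s ∧
            CfgCauchyΦOn (fun K n h V => PrintChi.ChiGood F γ (hF ▸ 𝔠).b₀ (hF ▸ 𝔠).p₀ ε₀ μ (n := n) (K := K) h V)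
              (AlphaInputsT3AC.dataOfV4chi p (canonPolymerRows fun K => (p K).toRows)) B (hF ▸ 𝔠).b₀ (hF ▸ 𝔠).p₀ a C_B fun _ => 1

/-- **THE DISPLAYED-SHAPE ROWS GIVE ★r1 g4's LETTER-FREE On-χ CHART ROWS** `K1aChartRowsOnChiKChiV4` (same rate `a`): kernel size `C_E := C_A·(max 1 (12/ρ))⁶` by the operator-norm
Cauchy inequalities (`kernelSizeΦ_of_chartAnalytic`), seventh-order row ON χ with `C_R := 2C_A(2C_s/ρ)⁷ + C_f` by §1 under the window `C_s·θ(n) ≤ ρ/4`, which the shrunk threshold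
`γB ⊓ gammaθ b₀ p₀ (ρ/(4·max 1 C_s))` supplies; vacuum constants `vacOf Φ`, rest `taylorRest Φ B + Rfar`. [cite: Balaban1985UV3, (7) p.257, (34) p.264, (57) p.270; King1986, Prop. 3.6 (3.55) p.662] -/
theorem k1aChartRowsOnChiKChiV4_of_displayedRowsOnChiKChiV4 {L : ℕ} {μ : ℝ} {𝔠 : AlphaConsts L (suGroupModel 2).N} {a₀ a₁ a : ℝ}
    (h : K1aDisplayedRowsOnChiKChiV4 L μ 𝔠 a₀ a₁ a) : K1aChartRowsOnChiKChiV4 L μ 𝔠 a₀ a₁ a := by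
  obtain ⟨ρ, C_A, C, C_f, C_s, C_B, γB, hρ, hCA, hC, hCf, hCs, hCB, hγB, hall⟩ := h
  have hb := 𝔠.b₀_pos
  have hp := 𝔠.p₀_pos
  have hm0 : 0 < max 1 C_s := lt_of_lt_of_le one_pos (le_max_left _ _)
  refine ⟨C, C_A * (max 1 (12 / ρ)) ^ 6, 2 * C_A * (2 * C_s / ρ) ^ 7 + C_f, C_s, C_B, min γB (gammaθ 𝔠.b₀ 𝔠.p₀ (ρ / (4 * max 1 C_s))),
    hC, by positivity, by positivity, hCs, hCB, lt_min hγB (gammaθ_pos hb hp (by positivity)), fun F γ hF hγ hγle hγ1 hOf => ?_⟩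
  subst hF
  have hγB' : γ ≤ γB := hγle.trans (min_le_left _ _)
  have hγw : γ ≤ gammaθ 𝔠.b₀ 𝔠.p₀ (ρ / (4 * max 1 C_s)) := hγle.trans (min_le_right _ _)
  have hγ1' : γ ≤ 1 := hγ1.trans (sq_min_one_le _ 𝔠.gamma0_pos)
  have hLn : 1 ≤ F.L := F.hL.2.le
  have hL1 : (1 : ℝ) ≤ (F.L : ℝ) := by exact_mod_cast hLn
  have hθ0 : ∀ n, 0 ≤ θBal F.L γ 𝔠.b₀ 𝔠.p₀ n := fun n => (T3MinimiserStabilityReduction.θBal_pos hLn hγ hγ1' hb 𝔠.p₀ n).le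
  have hwin : ∀ n, C_s * θBal F.L γ 𝔠.b₀ 𝔠.p₀ n ≤ ρ / 4 := fun n => window_taylor_le hLn hb hp hρ hγ hγ1' hγw n
  obtain ⟨p, hp', hrows⟩ := hall F γ rfl hγ hγB' hγ1 hOf
  refine ⟨p, hp', fun ε₀ hε hεa => ?_⟩
  obtain ⟨Φ, B, Rfar, hT, hA, h32, hK, hfar, hS, hBC⟩ := hrows ε₀ hε hεa
  exact ⟨Φ, vacOf Φ, B, taylorRest Φ B + Rfar, hT, hK, kernelSizeΦ_of_chartAnalytic hA,
    remainderSmallΦOn_of_chartAnalytic _ hCA hCs hρ hL1 hθ0 hwin hA h32 hS hfar, hS, hBC⟩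

/-- **THE REGISTERED STUB (i*)χ FROM THE DISPLAYED-SHAPE CHART ROWS ON PRINT'S χ, BY NAME** (`GlobalSlackCanonicalOnChi.smallBlocksSlackOnChiAllChiV4_of_k1aChartRowsOnChiKChiV4 ∘
k1aChartRowsOnChiKChiV4_of_displayedRowsOnChiKChiV4`): if for every odd `1 < L < 7`, every margin `μ ∈ (0,1)`, every constants record and [7]-constants there is a rate exponent
`0 < a < 1` with `K1aDisplayedRowsOnChiKChiV4 L μ 𝔠 a₀ a₁ a`, then the text of `stub_smallBlocksSlackOnChiAllChiV4` (skeleton v5kC of stmt-QuantumFields-20520, OWNER C3 pen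
`birth_v5kC.lean` 3aa24e4fa8fcb956) holds VERBATIM — the kernel-size row (34) and the seventh-order row (57) are no longer inputs of the (i*)χ line.
[cite: Balaban1985UV3, (34) p.264, (47) p.267, (57) p.270; King1986, Thm 3.4 (3.9) p.656, Prop. 3.6 p.662] -/
theorem smallBlocksSlackOnChiAllChiV4_of_displayedRowsOnChiKChiV4
    (h : ∀ (L : ℕ), Odd L → 1 < L → L < 7 → ∀ (μ : ℝ), 0 < μ → μ < 1 → ∀ (𝔠 : AlphaConsts L (suGroupModel 2).N) (a₀ a₁ : ℝ),
      0 < a₀ → 0 < a₁ → 𝔠.B₃ * a₁ ≤ a₀ → ∃ a : ℝ, 0 < a ∧ a < 1 ∧ K1aDisplayedRowsOnChiKChiV4 L μ 𝔠 a₀ a₁ a) :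
    ∀ (L : ℕ), Odd L → 1 < L → L < 7 → ∀ (μ : ℝ), 0 < μ → μ < 1 →
      ∀ (𝔠 : Summit.QuantumFields.Balaban3D.Proofs.Primitives.AlphaConsts L (Summit.QuantumFields.Balaban3D.Carriers.suGroupModel 2).N)
        (a₀ a₁ : ℝ), 0 < a₀ → 0 < a₁ → 𝔠.B₃ * a₁ ≤ a₀ →
        ∃ a : ℝ, 0 < a ∧ ∃ γB : ℝ, 0 < γB ∧ ∀ (F : T3Family) (γ : ℝ) (hF : F.L = L) (hγ : 0 < γ), γ ≤ γB →
          ∀ (hγ1 : γ ≤ (min (hF ▸ 𝔠).gamma0 1) ^ 2),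
            Summit.QuantumFields.YangMills.Theorems.AlphaInputsT3AC.OfV4ChiAt F (hF ▸ 𝔠) a₀ a₁ →
            ∃ (p : ∀ K, Summit.QuantumFields.YangMills.Theorems.AlphaInputsT3AC.PkgAtV4Chi F (hF ▸ 𝔠) γ hγ hγ1 K),
              (∀ K, (p K).a₀ = a₀ ∧ (p K).a₁ = a₁) ∧
              ∃ (π : Summit.QuantumFields.YangMills.Theorems.AlphaInputsT3AC.PolymerT3 F) (σ : ℕ) (C : ℝ), 7 ≤ σ ∧ 0 ≤ C ∧
                ∀ ε₀ : ℝ, 0 < ε₀ → ε₀ ≤ a₀ →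
                  Summit.QuantumFields.YangMills.Theorems.PrintChi.GlobalSupRateTSlackOn
                    (fun K n h V => Summit.QuantumFields.YangMills.Theorems.PrintChi.ChiGood F γ (hF ▸ 𝔠).b₀ (hF ▸ 𝔠).p₀ ε₀ μ (n := n) (K := K) h V)
                    (Summit.QuantumFields.YangMills.Theorems.AlphaInputsT3AC.dataOfV4chi p π) (hF ▸ 𝔠).b₀ (hF ▸ 𝔠).p₀ a σ C :=
  smallBlocksSlackOnChiAllChiV4_of_k1aChartRowsOnChiKChiV4 fun L hLo hL1 hL7 μ hμ0 hμ1 𝔠 a₀ a₁ ha0 ha1 hw => by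
    obtain ⟨a, ha, ha1', hc⟩ := h L hLo hL1 hL7 μ hμ0 hμ1 𝔠 a₀ a₁ ha0 ha1 hw
    exact ⟨a, ha, ha1', k1aChartRowsOnChiKChiV4_of_displayedRowsOnChiKChiV4 hc⟩

end Displayed

end Summit.QuantumFields.YangMills.Theorems.GlobalSlackKernelMatchingOn

end
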